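import Summits.Ventures.LatticeQCDFlow.Scaling.TemporalPlaquetteLogConvex
import Summits.Ventures.LatticeQCDFlow.Scaling.CrossCutFloorAnySeparation

/-!
HONEST FRAMING: exact (Metropolis-corrected) sampling algorithms for lattice gauge theory; figures
of merit are autocorrelation/cost numbers at stated couplings and volumes; no continuum-physics
claim.

# TemporalPlaquetteFloor — THE IN-PLANE CORRELATOR OF A PLAQUETTE IS LOG-CONVEX FROM SEPARATION
# TWO ON, ON EVERY TORUS; A FLOOR AT ANY IN-PLANE SEPARATION `≥ 2` IS A GEOMETRIC FLOOR AT ALL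
# SEPARATIONS (lean-1 GEN-12, ours; part 2 of 3 of the in-plane half of the clustering-floor
# structure theorem)

Venture-side (OURS). Cell `lqcd-flow` (pub-lqcd), unit `pub-lqcd-lean-1-g12`, 2026-08-23.  With
`G(m) = ⟨P_0 P_m⟩ − ⟨P_0⟩⟨P_m⟩` (`PlaquetteCorrelatorRP.tCorr ρ β x 0 j m`, `x 0 = 0`, `j ≠ 0`) the
truncated correlator of the TEMPORAL plaquette `(x; 0, j)` with its translates by `m` time units —
i.e. of two parallel plaquettes separated along an axis of their own plane — the Schwarz
inequalities of `TemporalPlaquetteLogConvex` give, on every torus `L ≥ 4` at `β ≥ 0`: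

* §1 the diagonal terms `0 ≤ G(2m)` (`1 ≤ m`, `2m + 1 ≤ L`), `0 ≤ G(2m+1)` (`L` even,
  `m + 1 ≤ L/2`, any `β`), hence `0 ≤ G(1)` (`L ≥ 2`), `0 ≤ G(2)` (`L ≥ 3`);
* §2 **`G(n)² ≤ G(n−1)·G(n+1)` for every `2 ≤ n ≤ L − 2`** (`sq_tCorr_le_temporal`; by parity —
  even `n` from the site form / odd tori by `G(n) = G(L − n)`, odd `n ≥ 3` from the link and mixed
  forms; `n = 1` is NOT available: a temporal plaquette based in the slice `0` straddles the link
  hyperplane, so `G(1)² ≤ G(0)G(2)` is not a reflection-positivity instance);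
* §3 one more fact about positive log-convex symmetric sequences (`head_le_of_logConvex_symm`:
  `g(1) ≤ g(0)` when `g(P − a) = g(a)`), applied with gen-11's `logConvex_eq_zero_of_one_eq_zero`,
  `le_one_of_logConvex_symm`, `geom_lower_of_logConvex` to the SHIFTED sequence `k ↦ G(k+1)`, which
  is log-convex from `k = 1` and `(L−2)`-symmetric:
* §4 **`tCorr_two_ge_of_abs_temporal`: a floor `δ ≤ |G(m)|` at ANY in-plane separation
  `2 ≤ m ≤ (L+1)/2` forces `δ ≤ G(2)`** (zeros of `G(2)` propagate to every `2 ≤ m ≤ L − 2`;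
  otherwise `G(1), …, G(L−1) > 0` and `G` is non-increasing from `1` to the middle), and
  `0 < G(2) ⇒ 0 < G(1)`, `G(2) ≤ G(1)`;
* §5 **`tCorr_ge_geometric_temporal`: `0 < δ ≤ G(2)` ⇒ `δ·(δ/N²)ⁿ ≤ G(n)` for all `n ≤ L − 1`**
  (`G(0) ≥ G(1) ≥ G(2) ≥ δ` and `G(n) ≥ G(1)(G(2)/G(1))^{n−1}`, `G(1) ≤ G(0) ≤ N²`).

So, exactly as in the transverse case but ONE SEPARATION LATER, a volume-uniform floor at any one
in-plane separation `m ≥ 2` propagates geometrically to all separations; a floor at `m = 1` alone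
does not (no handle on `G(2)/G(1)`).  The sequel `ClusteringFloorInPlane` reads this as: at every
`β > 0`, in-plane (U″) ⇔ in-plane (U′)_R for every `R ≥ 1`.
NOT CLAIMED: `β < 0`; anything from a floor at in-plane separation `1` only; any VALUE of the floor
(the strong-coupling in-plane input — a leading coefficient at in-plane separation `≥ 2` uniformly in
`L` — is not in the tree: gen-8/9/10's slab chain stacks spatial plaquettes).  Literature grade
(cell rule): known mechanism (reflection positivity ⇒ log-convexity ⇒ monotone ratios); new typing,
no new theorem of physics.
-/

noncomputable section

namespace Summit.Ventures.LatticeQCDFlow.Theory2.Clustering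

open MeasureTheory Literature.MathematicalPhysics.QuantumFieldTheory
open Literature.MathematicalPhysics.QuantumFieldTheory.FariaDaVeigaOCarroll2022
open Literature.MathematicalPhysics.QuantumFieldTheory.FariaDaVeigaOCarroll2022.MultiReflection

section Torus

variable {d L N : ℕ} [NeZero d] [NeZero L] {G : Type*} [Group G] [TopologicalSpace G]
  [IsTopologicalGroup G] [CompactSpace G] [MeasurableSpace G] [BorelSpace G]
  [SecondCountableTopology G] (ρ : G →* Matrix (Fin N) (Fin N) ℂ)

/-! ## §1 The diagonal terms: `G(2m) ≥ 0`, `G(2m+1) ≥ 0`, in particular `G(1), G(2) ≥ 0` -/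

/-- **`0 ≤ G(2m)` for `1 ≤ m`, `2m + 1 ≤ L`, `β ≥ 0`** (the reflection form on the diagonal:
links on the even torus, the mixed reflection on the odd torus — there `m = L/2` is allowed). -/
theorem tCorr_even_nonneg_temporal (hρ : Continuous ρ) {β : ℝ} (hβ : 0 ≤ β) {x : Site d L}
    (hx : x 0 = 0) {j : Fin d} (hj : j ≠ 0) {m : ℕ} (hm1 : 1 ≤ m) (hm : 2 * m + 1 ≤ L) :
    0 ≤ tCorr ρ β x 0 j (((2 * m : ℕ) : ZMod L)) := by
  haveI := isProbabilityMeasure_wilsonMeasure (d := d) (L := L) ρ hρ β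
  haveI : Fact (1 < L) := ⟨by omega⟩
  set c := wilsonExpectation ρ β (tObs ρ x 0 j 0) with hc
  obtain ⟨hAm, hAb, -⟩ := centred_Pobs_props_temporal ρ hρ x hj ((m : ℕ) : ZMod L) c
  have hpos : 0 ≤ ∫ U, (tObs ρ x 0 j ((m : ℕ) : ZMod L) U - c)
      * (tObs ρ x 0 j ((m : ℕ) : ZMod L) U.timeReflect - c) ∂(wilsonMeasure ρ β) := by
    rcases Nat.even_or_odd L with ⟨r, hr⟩ | hO
    · exact integral_mul_timeReflect_nonneg ρ ⟨r, hr⟩ hρ hβ hAm hAb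
        (dependsOn_isPosEdge_temporal ρ hρ hx hj c hm1 (by omega))
    · exact integral_mul_timeReflect_nonneg_odd ρ hO (by omega) hρ hβ hAm hAb
        (dependsOn_odd_temporal ρ (by omega) hρ hx hj c hm1 (by omega))
  rw [hc, integral_centred_timeReflect_temporal ρ hρ β hx hj] at hpos
  have e : ((m : ℕ) : ZMod L) + ((m : ℕ) : ZMod L) = (((2 * m : ℕ) : ZMod L)) := by push_cast; ring
  rwa [e] at hpos

/-- **`0 ≤ G(2m + 1)` for `m + 1 ≤ L/2` on the even torus, every real `β`** (site reflection). -/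
theorem tCorr_odd_nonneg_temporal (hL : Even L) (hρ : Continuous ρ) (β : ℝ) {x : Site d L}
    (hx : x 0 = 0) {j : Fin d} (hj : j ≠ 0) {m : ℕ} (hm : m + 1 ≤ L / 2) :
    0 ≤ tCorr ρ β x 0 j (((2 * m + 1 : ℕ) : ZMod L)) := by
  haveI := isProbabilityMeasure_wilsonMeasure (d := d) (L := L) ρ hρ β
  haveI : Fact (1 < L) := ⟨by omega⟩
  set c := wilsonExpectation ρ β (tObs ρ x 0 j 0) with hc
  obtain ⟨hAm, hAb, -⟩ := centred_Pobs_props_temporal ρ hρ x hj ((m : ℕ) : ZMod L) c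
  have hpos : 0 ≤ ∫ U, (tObs ρ x 0 j ((m : ℕ) : ZMod L) U - c)
      * (tObs ρ x 0 j ((m : ℕ) : ZMod L) U.negReflect - c) ∂(wilsonMeasure ρ β) :=
    integral_mul_negReflect_nonneg ρ hL hρ β hAm hAb (dependsOn_site_temporal ρ hρ hx hj c hm)
  rw [hc, integral_centred_negReflect_temporal ρ hρ β hx hj] at hpos
  have e : ((m : ℕ) : ZMod L) + ((m : ℕ) : ZMod L) + 1 = (((2 * m + 1 : ℕ) : ZMod L)) := by
    push_cast; ring
  rwa [e] at hpos

/-- **`0 ≤ G(1)` on every torus with `L ≥ 2`, `β ≥ 0`** (even torus: the site reflection with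
`m = 0`; odd torus `L = 2K + 1`: `G(1) = G(L − 1) = G(2K)`, the mixed reflection with `m = K`). -/
theorem tCorr_one_nonneg_temporal (hL2 : 2 ≤ L) (hρ : Continuous ρ) {β : ℝ} (hβ : 0 ≤ β)
    {x : Site d L} (hx : x 0 = 0) {j : Fin d} (hj : j ≠ 0) :
    0 ≤ tCorr ρ β x 0 j 1 := by
  rcases Nat.even_or_odd L with hE | ⟨K, hK⟩
  · have h := tCorr_odd_nonneg_temporal ρ hE hρ β hx hj (m := 0) (by omega)
    norm_num at h
    exact h
  · have h := tCorr_even_nonneg_temporal ρ hρ hβ hx hj (m := K) (by omega) (by omega)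
    rw [show 2 * K = L - 1 by omega, tCorr_sub_eq ρ β x 0 j (by omega : 1 ≤ L)] at h
    norm_num at h
    exact h

/-- **`0 ≤ G(2)` on every torus with `L ≥ 3`, `β ≥ 0`** (`m = 1`). -/
theorem tCorr_two_nonneg_temporal (hL3 : 3 ≤ L) (hρ : Continuous ρ) {β : ℝ} (hβ : 0 ≤ β)
    {x : Site d L} (hx : x 0 = 0) {j : Fin d} (hj : j ≠ 0) :
    0 ≤ tCorr ρ β x 0 j 2 := by
  have h := tCorr_even_nonneg_temporal ρ hρ hβ hx hj (m := 1) le_rfl (by omega)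
  norm_num at h
  exact h


/-! ## §2 Log-convexity from separation two on, on every torus -/

/-- **LOG-CONVEXITY OF THE IN-PLANE CORRELATOR ON EVERY TORUS.**  For `L ≥ 4`, `β ≥ 0`, a time-zero
base site, `j ≠ 0` and every `2 ≤ n ≤ L − 2`: `G(n)² ≤ G(n−1)·G(n+1)`. -/
theorem sq_tCorr_le_temporal (hL4 : 4 ≤ L) (hρ : Continuous ρ) {β : ℝ} (hβ : 0 ≤ β) {x : Site d L}
    (hx : x 0 = 0) {j : Fin d} (hj : j ≠ 0) {n : ℕ} (hn2 : 2 ≤ n) (hn : n + 2 ≤ L) :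
    (tCorr ρ β x 0 j ((n : ℕ) : ZMod L)) ^ 2
      ≤ tCorr ρ β x 0 j (((n - 1 : ℕ)) : ZMod L) * tCorr ρ β x 0 j (((n + 1 : ℕ)) : ZMod L) := by
  rcases Nat.even_or_odd L with ⟨r, hr⟩ | ⟨K, hK⟩
  · rcases Nat.even_or_odd n with ⟨k, hk⟩ | ⟨k, hk⟩
    · -- even torus, even `n = 2k`: site reflection with `s = k − 1`, `t = k`
      have h := sq_tCorr_le_site_temporal ρ ⟨r, hr⟩ hρ β hx hj (s := k - 1) (t := k) (by omega)
        (by omega)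
      have e1 : k - 1 + k + 1 = n := by omega
      have e2 : 2 * k + 1 = n + 1 := by omega
      have e3 : 2 * (k - 1) + 1 = n - 1 := by omega
      rw [e1, e2, e3, mul_comm] at h
      exact h
    · -- even torus, odd `n = 2k + 1 ≥ 3`: link reflection with `s = k`, `t = k + 1`
      have h := sq_tCorr_le_link_temporal ρ ⟨r, hr⟩ hρ hβ hx hj (s := k) (t := k + 1) (by omega)
        (by omega) (by omega) (by omega)
      have e1 : k + (k + 1) = n := by omega
      have e2 : 2 * (k + 1) = n + 1 := by omega
      have e3 : 2 * k = n - 1 := by omega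
      rw [e1, e2, e3, mul_comm] at h
      exact h
  · rcases Nat.even_or_odd n with ⟨k, hk⟩ | ⟨k, hk⟩
    · -- odd torus `L = 2K + 1`, even `n = 2k`: use `n' = L − n = 2(K − k) + 1`, odd, `≥ 3`
      have h := sq_tCorr_le_odd_temporal ρ ⟨K, hK⟩ (by omega) hρ hβ hx hj (s := K - k)
        (t := K - k + 1) (by omega) (by omega) (by omega) (by omega)
      have e1 : K - k + (K - k + 1) = L - n := by omega
      have e2 : 2 * (K - k + 1) = L - (n - 1) := by omega
      have e3 : 2 * (K - k) = L - (n + 1) := by omega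
      rw [e1, e2, e3, tCorr_sub_eq ρ β x 0 j (by omega), tCorr_sub_eq ρ β x 0 j (by omega),
        tCorr_sub_eq ρ β x 0 j (by omega)] at h
      exact h
    · -- odd torus, odd `n = 2k + 1 ≥ 3`: the mixed reflection with `s = k`, `t = k + 1`
      have h := sq_tCorr_le_odd_temporal ρ ⟨K, hK⟩ (by omega) hρ hβ hx hj (s := k) (t := k + 1)
        (by omega) (by omega) (by omega) (by omega)
      have e1 : k + (k + 1) = n := by omega
      have e2 : 2 * (k + 1) = n + 1 := by omega
      have e3 : 2 * k = n - 1 := by omega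
      rw [e1, e2, e3, mul_comm] at h
      exact h

/-- The same in SHIFTED form: `G(k+1)² ≤ G(k)·G(k+2)` for `1 ≤ k`, `k + 3 ≤ L` — the sequence
`k ↦ G(k+1)` is log-convex from `k = 1`. -/
theorem sq_tCorr_succ_le_temporal (hL4 : 4 ≤ L) (hρ : Continuous ρ) {β : ℝ} (hβ : 0 ≤ β)
    {x : Site d L} (hx : x 0 = 0) {j : Fin d} (hj : j ≠ 0) {k : ℕ} (hk1 : 1 ≤ k) (hk : k + 3 ≤ L) :
    (tCorr ρ β x 0 j (((k + 1 : ℕ)) : ZMod L)) ^ 2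
      ≤ tCorr ρ β x 0 j ((k : ℕ) : ZMod L) * tCorr ρ β x 0 j (((k + 1 + 1 : ℕ)) : ZMod L) := by
  have h := sq_tCorr_le_temporal ρ hL4 hρ hβ hx hj (n := k + 1) (by omega) (by omega)
  rwa [Nat.add_sub_cancel] at h

omit [SecondCountableTopology G] in
/-- Periodicity in shifted form: `G((L − 2 − a) + 1) = G(a + 1)` for `a ≤ L − 2` — the sequence
`k ↦ G(k+1)` is `(L−2)`-symmetric. -/
theorem tCorr_succ_symm_temporal (β : ℝ) (x : Site d L) (j : Fin d) {a : ℕ} (ha : a + 2 ≤ L) :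
    tCorr ρ β x 0 j (((L - 2 - a + 1 : ℕ)) : ZMod L) = tCorr ρ β x 0 j (((a + 1 : ℕ)) : ZMod L) := by
  rw [show L - 2 - a + 1 = L - (a + 1) by omega, tCorr_sub_eq ρ β x 0 j (by omega)]

/-! ## §3 One more fact about positive log-convex symmetric sequences -/

/-- **The head of a positive, log-convex, `P`-symmetric sequence**: `g(1) ≤ g(0)` (the first ratio
is at most the last one, which is its inverse). [folklore] -/
theorem head_le_of_logConvex_symm {g : ℕ → ℝ} {P : ℕ} (hP : 1 ≤ P) (hpos : ∀ n, n ≤ P → 0 < g n)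
    (hconv : ∀ n, 1 ≤ n → n + 1 ≤ P → g n ^ 2 ≤ g (n - 1) * g (n + 1))
    (hsym : ∀ a, a ≤ P → g (P - a) = g a) : g 1 ≤ g 0 := by
  have hr := ratio_le_of_logConvex hpos hconv 1 P le_rfl hP le_rfl
  rw [hsym 1 hP, Nat.sub_self, show g P = g 0 by simpa using hsym 0 (Nat.zero_le P)] at hr
  have h0 := hpos 0 (Nat.zero_le P)
  by_contra h
  rw [not_le] at h
  have := mul_self_lt_mul_self h0.le h
  linarith

/-! ## §4 A floor at any in-plane separation `≥ 2` up to the middle is a floor at separation two -/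

/-- `0 < G(2) ⇒ 0 < G(1)` (`L ≥ 4`, `β ≥ 0`): `G(2)² ≤ G(1)·G(3)` and `G(1) ≥ 0`. -/
theorem tCorr_one_pos_of_two_pos_temporal (hL4 : 4 ≤ L) (hρ : Continuous ρ) {β : ℝ} (hβ : 0 ≤ β)
    {x : Site d L} (hx : x 0 = 0) {j : Fin d} (hj : j ≠ 0) (h2 : 0 < tCorr ρ β x 0 j 2) :
    0 < tCorr ρ β x 0 j 1 := by
  have h1 := tCorr_one_nonneg_temporal ρ (by omega) hρ hβ hx hj
  rcases h1.eq_or_lt with h | h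
  · exfalso
    have hc := sq_tCorr_le_temporal ρ hL4 hρ hβ hx hj (n := 2) le_rfl (by omega)
    norm_num at hc
    rw [← h, zero_mul] at hc
    nlinarith
  · exact h

/-- **`δ ≤ |G(m)|` AT ANY IN-PLANE SEPARATION `2 ≤ m ≤ (L+1)/2` FORCES `δ ≤ G(2)`** (`L ≥ 4`,
`β ≥ 0`, time-zero base site, temporal orientation `(0, j)`, `j ≠ 0`).  If `G(2) = 0` every `G(m)`,
`2 ≤ m ≤ L − 2`, vanishes; otherwise `G(1), …, G(L−1) > 0` and `G` is non-increasing from `1` up to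
the middle of the torus. -/
theorem tCorr_two_ge_of_abs_temporal (hL4 : 4 ≤ L) (hρ : Continuous ρ) {β : ℝ} (hβ : 0 ≤ β)
    {x : Site d L} (hx : x 0 = 0) {j : Fin d} (hj : j ≠ 0) {m : ℕ} (hm2 : 2 ≤ m)
    (hm : 2 * m ≤ L + 1) {δ : ℝ} (hδ : 0 < δ)
    (hδm : δ ≤ |tCorr ρ β x 0 j ((m : ℕ) : ZMod L)|) : δ ≤ tCorr ρ β x 0 j 2 := by
  -- the shifted sequence `g k = G(k + 1)`
  set g : ℕ → ℝ := fun k => tCorr ρ β x 0 j (((k + 1 : ℕ)) : ZMod L) with hg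
  have hg0 : g 0 = tCorr ρ β x 0 j 1 := by simp [hg]
  have hg1 : g 1 = tCorr ρ β x 0 j 2 := by simp only [hg]; norm_num
  have hgm : g (m - 1) = tCorr ρ β x 0 j ((m : ℕ) : ZMod L) := by
    simp only [hg, Nat.sub_add_cancel (by omega : 1 ≤ m)]
  have hconv : ∀ k, 1 ≤ k → k + 1 ≤ L - 2 → g k ^ 2 ≤ g (k - 1) * g (k + 1) := by
    intro k hk1 hk
    have h := sq_tCorr_succ_le_temporal ρ hL4 hρ hβ hx hj hk1 (by omega)
    simp only [hg, Nat.sub_add_cancel hk1]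
    exact h
  have hsym : ∀ a, a ≤ L - 2 → g (L - 2 - a) = g a := fun a ha =>
    tCorr_succ_symm_temporal ρ β x j (by omega)
  have h2nn : 0 ≤ g 1 := by rw [hg1]; exact tCorr_two_nonneg_temporal ρ (by omega) hρ hβ hx hj
  rw [← hgm] at hδm
  rw [← hg1]
  rcases h2nn.eq_or_lt with h1 | h1
  · -- `G(2) = 0` kills `G(m)`: contradiction with the floor
    exfalso
    have hz : g (m - 1) = 0 := by
      rcases Nat.lt_or_ge m (L - 2) with hlt | hge
      · exact logConvex_eq_zero_of_one_eq_zero hconv h1.symm (m - 1) (by omega) (by omega)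
      · have hmeq : m - 1 = L - 2 - 1 := by omega
        rw [hmeq, hsym 1 (by omega)]
        exact h1.symm
    rw [hz, abs_zero] at hδm
    exact absurd hδm (not_le.2 hδ)
  · have h2 : 0 < tCorr ρ β x 0 j 2 := hg1 ▸ h1
    have h0 : 0 < g 0 := by
      rw [hg0]; exact tCorr_one_pos_of_two_pos_temporal ρ hL4 hρ hβ hx hj h2
    have hpos : ∀ n, n ≤ L - 2 → 0 < g n := fun n hn =>
      (geom_lower_of_logConvex h0 h1 hconv n hn).1
    have hmle : g (m - 1) ≤ g 1 :=
      le_one_of_logConvex_symm (L := L - 2) (fun n hn => hpos n (by omega))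
        (fun n hn1 hn => hconv n hn1 (by omega)) hsym (m - 1) (by omega) (by omega)
    rw [abs_of_pos (hpos (m - 1) (by omega))] at hδm
    exact hδm.trans hmle

/-- `G(2) ≤ G(1)` whenever `G(2) > 0` (`L ≥ 4`, `β ≥ 0`): the shifted sequence is positive,
log-convex and `(L−2)`-symmetric. -/
theorem tCorr_two_le_one_temporal (hL4 : 4 ≤ L) (hρ : Continuous ρ) {β : ℝ} (hβ : 0 ≤ β)
    {x : Site d L} (hx : x 0 = 0) {j : Fin d} (hj : j ≠ 0) (h2 : 0 < tCorr ρ β x 0 j 2) :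
    tCorr ρ β x 0 j 2 ≤ tCorr ρ β x 0 j 1 := by
  set g : ℕ → ℝ := fun k => tCorr ρ β x 0 j (((k + 1 : ℕ)) : ZMod L) with hg
  have hg0 : g 0 = tCorr ρ β x 0 j 1 := by simp [hg]
  have hg1 : g 1 = tCorr ρ β x 0 j 2 := by simp only [hg]; norm_num
  have hconv : ∀ k, 1 ≤ k → k + 1 ≤ L - 2 → g k ^ 2 ≤ g (k - 1) * g (k + 1) := by
    intro k hk1 hk
    have h := sq_tCorr_succ_le_temporal ρ hL4 hρ hβ hx hj hk1 (by omega)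
    simp only [hg, Nat.sub_add_cancel hk1]
    exact h
  have hsym : ∀ a, a ≤ L - 2 → g (L - 2 - a) = g a := fun a ha =>
    tCorr_succ_symm_temporal ρ β x j (by omega)
  have h0 : 0 < g 0 := by
    rw [hg0]; exact tCorr_one_pos_of_two_pos_temporal ρ hL4 hρ hβ hx hj h2
  have h1 : 0 < g 1 := by rw [hg1]; exact h2
  have hpos : ∀ n, n ≤ L - 2 → 0 < g n := fun n hn =>
    (geom_lower_of_logConvex h0 h1 hconv n hn).1
  rw [← hg0, ← hg1]
  exact head_le_of_logConvex_symm (P := L - 2) (by omega) hpos hconv hsym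

/-! ## §5 The geometric floor on one torus -/

/-- **THE IN-PLANE GEOMETRIC FLOOR ON ONE TORUS.**  For `L ≥ 4`, `β ≥ 0`, a time-zero base site,
temporal orientation `(0, j)`, `j ≠ 0`: if `0 < δ ≤ G(2)` then `δ·(δ/N²)ⁿ ≤ G(n)` for all
`n ≤ L − 1` (so `G > 0` everywhere, with in-plane plaquette mass `≤ log(N²/δ)`). -/
theorem tCorr_ge_geometric_temporal (hL4 : 4 ≤ L) (hρ : Continuous ρ) {β : ℝ} (hβ : 0 ≤ β)
    {x : Site d L} (hx : x 0 = 0) {j : Fin d} (hj : j ≠ 0) {δ : ℝ} (hδ : 0 < δ)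
    (hδ2 : δ ≤ tCorr ρ β x 0 j 2) {n : ℕ} (hn : n + 1 ≤ L) :
    δ * (δ / (N : ℝ) ^ 2) ^ n ≤ tCorr ρ β x 0 j ((n : ℕ) : ZMod L) := by
  set g : ℕ → ℝ := fun k => tCorr ρ β x 0 j (((k + 1 : ℕ)) : ZMod L) with hg
  have hg0 : g 0 = tCorr ρ β x 0 j 1 := by simp [hg]
  have hg1 : g 1 = tCorr ρ β x 0 j 2 := by simp only [hg]; norm_num
  have h2 : 0 < tCorr ρ β x 0 j 2 := lt_of_lt_of_le hδ hδ2
  have h21 := tCorr_two_le_one_temporal ρ hL4 hρ hβ hx hj h2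
  have h10 := tCorr_one_le_zero ρ hρ β x 0 j
  have hN2 := tCorr_zero_le ρ hρ β x 0 j
  have h1 : 0 < g 1 := by rw [hg1]; exact h2
  have h0 : 0 < g 0 := by rw [hg0]; linarith
  have hconv : ∀ k, 1 ≤ k → k + 1 ≤ L - 2 → g k ^ 2 ≤ g (k - 1) * g (k + 1) := by
    intro k hk1 hk
    have h := sq_tCorr_succ_le_temporal ρ hL4 hρ hβ hx hj hk1 (by omega)
    simp only [hg, Nat.sub_add_cancel hk1]
    exact h
  have hNpos : 0 < (N : ℝ) ^ 2 := by linarith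
  have hq : 0 ≤ δ / (N : ℝ) ^ 2 := div_nonneg hδ.le hNpos.le
  have hq1 : δ / (N : ℝ) ^ 2 ≤ 1 := by
    rw [div_le_one hNpos]; linarith
  -- the ratio `δ/N² ≤ G(2)/G(1)`
  have hr : δ / (N : ℝ) ^ 2 ≤ g 1 / g 0 := by
    rw [div_le_div_iff₀ hNpos h0, hg0, hg1]
    calc δ * tCorr ρ β x 0 j 1 ≤ δ * (N : ℝ) ^ 2 :=
          mul_le_mul_of_nonneg_left (by linarith) hδ.le
      _ ≤ tCorr ρ β x 0 j 2 * (N : ℝ) ^ 2 := mul_le_mul_of_nonneg_right hδ2 hNpos.le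
  rcases n with _ | k
  · -- `n = 0`: `δ ≤ G(2) ≤ G(1) ≤ G(0)`
    simp only [pow_zero, mul_one, Nat.cast_zero]
    linarith
  · -- `n = k + 1`: `δ (δ/N²)^{k+1} ≤ G(1) (G(2)/G(1))^k ≤ G(k+1)`
    obtain ⟨-, hge⟩ := geom_lower_of_logConvex h0 h1 hconv k (by omega)
    refine le_trans ?_ hge
    calc δ * (δ / (N : ℝ) ^ 2) ^ (k + 1) = (δ * (δ / (N : ℝ) ^ 2)) * (δ / (N : ℝ) ^ 2) ^ k := by
          ring
      _ ≤ g 0 * (δ / (N : ℝ) ^ 2) ^ k := by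
          refine mul_le_mul_of_nonneg_right ?_ (pow_nonneg hq k)
          calc δ * (δ / (N : ℝ) ^ 2) ≤ δ * 1 := mul_le_mul_of_nonneg_left hq1 hδ.le
            _ ≤ g 0 := by rw [mul_one, hg0]; linarith
      _ ≤ g 0 * (g 1 / g 0) ^ k :=
          mul_le_mul_of_nonneg_left (pow_le_pow_left₀ hq hr k) h0.le

end Torus

end Summit.Ventures.LatticeQCDFlow.Theory2.Clustering
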